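import Summits.Ventures.CertifiedManyBodySolver.Theorems.TcThermcert1GcGibbsFactorization
import Summits.Ventures.CertifiedManyBodySolver.Theorems.TcThermcert1GcWeightBound
import Summits.Ventures.CertifiedManyBodySolver.Theorems.TcThermcert1GcPolymerRepresentation
import Summits.Ventures.CertifiedManyBodySolver.Theorems.TcThermcert1GcNormalizationLog
import Summits.Ventures.CertifiedManyBodySolver.Theorems.TcThermcert1GcLocalTraces
import Summits.Ventures.CertifiedManyBodySolver.Theorems.TcThermcert1GcKPSmallness
import Summits.Ventures.CertifiedManyBodySolver.Theorems.TcThermcert1GcActivityBound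
import Summits.Ventures.CertifiedManyBodySolver.Theorems.TcThermcert1GcLocalUnfusing
import Summits.HubbardSuperconductivity.HubbardLadder.Bounds.TwistedActivitySmallness
import Literature.Probability.LatticeModels.WeightedSmallActivity
import Literature.Probability.LatticeModels.PolymerPressureAnalytic
import Literature.Probability.LatticeModels.PolymerLogZLipschitz
import Literature.Probability.LatticeModels.PSStability
import Literature.Analysis.Complex.OsgoodProofs
import Mathlib
import HarnessLib

/-!
# The two-complex-fugacity cluster expansion of the coupling polymer gas (K2, part 10: generic assembly)

Helper file for route `TcThermcert1`, crux `ThermalStiffnessCeilingU8b10_le_1o8` (item `stmt-Ventures-26381`), line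
`Cruxes/ThermalStiffnessCeilingU8b10_le_1o8/Lines/zerofree_corridor.lean`, registered stub K2 `stub_gcHighTempAnalytic`
(steps S4c/S5/S6 of `Cruxes/…/STUB-PLAN-stub_gcHighTempAnalytic.md`). It assembles parts 0–9 (`TcThermcert1Gc*.lean`) on a
generic finite lattice `Λ` with a bond graph of maximal degree `Δ`, over the explicit fugacity annulus pair `2/3 < |ζσ| < 8/9`:

* `twoFugacity_siteRatio_le`: the two-fugacity site ratio is `≤ 1000` on the annulus pair for `‖βU‖ ≤ 1/256`;
* `isSmallActivityA_twoFugacity`: Kotecký–Preiss smallness (weight `a`, decay `δ`) of the pushforward site activity for couplings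
  `|c_b| ≤ s` with `(8Δ+1)² e⁶ 10⁶ s ≤ 1/2`, `8Δ e⁶ 10⁶ s ≤ a`;
* `norm_polymerLogZ_le_of_isSmallActivityA`: `‖log Ξ‖ ≤ a · #sites`;
* `differentiableOn_twoFugacity_ratio` / `differentiableOn_twoFugacity_pushforward`: the local Gibbs ratios and the site activities are
  holomorphic in `(ζ↑, ζ↓)` on the annulus pair (through the UNFUSED local form of part 8 — no logarithm of a fugacity is differentiated);
* `twoFugacity_trace_instIrrel`: the Gibbs factor does not depend on the `DecidableEq` instance on configurations through which the
  matrix ring is found (transport between the instance synthesized on a concrete torus and the one carried by the generic lemmas);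
* `twoFugacity_cluster`: a complex-differentiable `P = log Ξ(ρ)` with `‖P‖ ≤ a|Λ|` and `tr e^{−βV + F(ζ) + Σ c_b T_b} = z₂^{|Λ|} e^{P}`
  on the annulus pair (factorisation property, polymer representation, exponential formula, parametric holomorphy of `log Ξ`).

[cite: Ueltschi1999, Thm 2.1, Prop 2.2, §2.3; KoteckyPreiss1986, Theorem p. 492] High-temperature expansion only: nothing about
superconductivity in the Hubbard model is proved by anything in this file. No definitions; no `sorry`.
-/

noncomputable section

namespace Summit.Ventures.CertifiedManyBodySolver.Theorems.TcThermcert1.ZeroFreeCorridor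

open Matrix Finset Complex
open Literature.MathematicalPhysics.QuantumLattice Literature.Probability.LatticeModels
open Summit.HubbardSuperconductivity.HubbardLadder.Bounds

/-! ## §1 Generic finite lattice `Λ` -/

section General

variable {Λ : Type*} [LinearOrder Λ] [Fintype Λ]

omit [LinearOrder Λ] [Fintype Λ] in
/-- **The two-fugacity site ratio is at most `1000`** on the annulus pair for `‖βU‖ ≤ 1/256`
(numerator `≤ 6`, `|z₂| ≥ |(1+ζ↑)(1+ζ↓)|/2 ≥ 1/162`). -/
theorem twoFugacity_siteRatio_le {ζ : ℂ × ℂ}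
    (hζ : ζ ∈ ({ζ : ℂ | 2 / 3 < ‖ζ‖ ∧ ‖ζ‖ < 8 / 9} ×ˢ {ζ : ℂ | 2 / 3 < ‖ζ‖ ∧ ‖ζ‖ < 8 / 9})) {β U : ℂ}
    (hβU : ‖β * U‖ ≤ 1 / 256) :
    (1 + ‖ζ.1‖ + ‖ζ.2‖ + ‖ζ.1‖ * ‖ζ.2‖ * Real.exp (-(β * U).re)) /
        ‖1 + ζ.1 + ζ.2 + ζ.1 * ζ.2 * cexp (-(β * U))‖ ≤ 1000 := by
  obtain ⟨h1, h2⟩ := Set.mem_prod.mp hζ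
  have hp : 1 / 81 ≤ ‖(1 + ζ.1) * (1 + ζ.2)‖ := (site_ratio_le_of_mem_annulus hζ).1
  have hpne : (1 + ζ.1) * (1 + ζ.2) ≠ 0 :=
    mul_ne_zero (one_add_ne_zero_of_mem_annulus h1) (one_add_ne_zero_of_mem_annulus h2)
  have hhalf := norm_zTwo_div_sub_one_le_half hζ hβU
  set z2 : ℂ := 1 + ζ.1 + ζ.2 + ζ.1 * ζ.2 * cexp (-(β * U)) with hz2def
  -- `|z₂ / p| ≥ 1/2`
  have hv : 1 / 2 ≤ ‖z2 / ((1 + ζ.1) * (1 + ζ.2))‖ := by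
    have h := norm_sub_norm_le (1 : ℂ) (1 - z2 / ((1 + ζ.1) * (1 + ζ.2)))
    rw [sub_sub_cancel, norm_one, norm_sub_rev] at h
    linarith
  -- `|z₂| ≥ 1/162`
  have hz2 : 1 / 162 ≤ ‖z2‖ := by
    have he : z2 = z2 / ((1 + ζ.1) * (1 + ζ.2)) * ((1 + ζ.1) * (1 + ζ.2)) := (div_mul_cancel₀ z2 hpne).symm
    rw [he, norm_mul]
    nlinarith [norm_nonneg (z2 / ((1 + ζ.1) * (1 + ζ.2))), norm_nonneg ((1 + ζ.1) * (1 + ζ.2))]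
  -- numerator `≤ 6`
  have hexp : Real.exp (-(β * U).re) ≤ 3 := by
    have hre : -(β * U).re ≤ 1 :=
      ((neg_le_abs _).trans (Complex.abs_re_le_norm _)).trans (hβU.trans (by norm_num))
    have := Real.exp_le_exp.2 hre
    have := Real.exp_one_lt_d9
    linarith
  have hnum : 1 + ‖ζ.1‖ + ‖ζ.2‖ + ‖ζ.1‖ * ‖ζ.2‖ * Real.exp (-(β * U).re) ≤ 6 := by
    have ha : ‖ζ.1‖ ≤ 1 := by linarith [h1.2]
    have hb : ‖ζ.2‖ ≤ 1 := by linarith [h2.2]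
    have hab : ‖ζ.1‖ * ‖ζ.2‖ ≤ 1 := by nlinarith [norm_nonneg ζ.1, norm_nonneg ζ.2]
    have : ‖ζ.1‖ * ‖ζ.2‖ * Real.exp (-(β * U).re) ≤ 1 * 3 :=
      mul_le_mul hab hexp (Real.exp_nonneg _) zero_le_one
    linarith
  have hz2pos : 0 < ‖z2‖ := by linarith
  rw [div_le_iff₀ hz2pos]
  linarith

/-- The two-fugacity generalised Gibbs factor is complex-differentiable in the couplings. -/
theorem differentiable_twoFugacityT (β U z w : ℂ) (T : (Bond Λ → ℂ) → ℂ)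
    (hT : ∀ c, T c = (NormedSpace.exp (-(β • onSiteSum U 0 (univ : Finset Λ)) +
      (∑ x ∈ (univ : Finset Λ), (Complex.log z • numberOp x 0 + Complex.log w • numberOp x 1)) + hopSum c)).trace) :
    Differentiable ℂ T := by
  rw [show T = fun c => (NormedSpace.exp (-(β • onSiteSum U 0 (univ : Finset Λ)) +
      (∑ x ∈ (univ : Finset Λ), (Complex.log z • numberOp x 0 + Complex.log w • numberOp x 1)) + hopSum c)).trace
    from funext hT]
  exact differentiable_trace_exp_add_hopSum _

/-- **The bond-weight bound of the two-fugacity coupling polymer gas**: `|W K| ≤ (e² s)^{|K|} r₂^{|supp K|}` for couplings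
`|c_b| ≤ s ≤ 1` (parts 5 and 7). -/
theorem norm_twoFugacityWeight_le {β U z w : ℂ} (hz : z ≠ 0) (hw : w ≠ 0)
    (h2 : 1 + z + w + z * w * cexp (-(β * U)) ≠ 0) (T : (Bond Λ → ℂ) → ℂ)
    (hT : ∀ c, T c = (NormedSpace.exp (-(β • onSiteSum U 0 (univ : Finset Λ)) +
      (∑ x ∈ (univ : Finset Λ), (Complex.log z • numberOp x 0 + Complex.log w • numberOp x 1)) + hopSum c)).trace)
    (W : Finset (Bond Λ) → ℂ) {c : Bond Λ → ℂ}
    (hW : ∀ K, W K = ∑ K' ∈ K.powerset, (-1) ^ (K \ K').card * (T (restrictCoupling c K') / T 0))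
    {s : ℝ} (hs0 : 0 ≤ s) (hs1 : s ≤ 1) (hc : ∀ b, ‖c b‖ ≤ s) (K : Finset (Bond Λ)) :
    ‖W K‖ ≤ (Real.exp 2 * s) ^ K.card *
      ((1 + ‖z‖ + ‖w‖ + ‖z‖ * ‖w‖ * Real.exp (-(β * U).re)) / ‖1 + z + w + z * w * cexp (-(β * U))‖) ^
        (cellSupp Bond.verts K).card :=
  norm_weight_le_of_activityBound T (differentiable_twoFugacityT β U z w T hT) (by positivity)
    (fun _ _ hd => norm_twoFugacity_ratio_le hz hw h2 T hT hd) W hW hs0 hs1 hc K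

/-- **Kotecký–Preiss smallness of the two-complex-fugacity coupling polymer gas** on a graph of maximal degree `Δ`
(parts 5, 7, 9 and the site-ratio bound): for `ζ` in the annulus pair, `‖βU‖ ≤ 1/256`, couplings `|c_b| ≤ s` with
`(8Δ+1)² e⁶10⁶ s ≤ 1/2` and `8Δ e⁶10⁶ s ≤ a`, `a + δ ≤ 2`. -/
theorem isSmallActivityA_twoFugacity {G : SimpleGraph Λ} [DecidableRel G.Adj] {Δ : ℕ}
    (hΔ : ∀ v : Λ, (Finset.univ.filter (G.Adj v)).card ≤ Δ) {β U : ℂ} {ζ : ℂ × ℂ}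
    (hζ : ζ ∈ ({ζ : ℂ | 2 / 3 < ‖ζ‖ ∧ ‖ζ‖ < 8 / 9} ×ˢ {ζ : ℂ | 2 / 3 < ‖ζ‖ ∧ ‖ζ‖ < 8 / 9}))
    (hβU : ‖β * U‖ ≤ 1 / 256) (T : (Bond Λ → ℂ) → ℂ)
    (hT : ∀ c, T c = (NormedSpace.exp (-(β • onSiteSum U 0 (univ : Finset Λ)) +
      (∑ x ∈ (univ : Finset Λ), (Complex.log ζ.1 • numberOp x 0 + Complex.log ζ.2 • numberOp x 1)) + hopSum c)).trace)
    (W : Finset (Bond Λ) → ℂ) {c : Bond Λ → ℂ}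
    (hW : ∀ K, W K = ∑ K' ∈ K.powerset, (-1) ^ (K \ K').card * (T (restrictCoupling c K') / T 0))
    {s : ℝ} (hs0 : 0 ≤ s) (hc : ∀ b, ‖c b‖ ≤ s)
    (hsmall : ((8 * Δ : ℕ) + 1 : ℝ) ^ 2 * (Real.exp 6 * 1000 ^ 2 * s) ≤ 1 / 2)
    {a δ : ℝ} (ha : 0 < a) (hδ : 0 < δ) (had : a + δ ≤ 2) (hsa : 8 * Δ * (Real.exp 6 * 1000 ^ 2 * s) ≤ a) :
    IsSmallActivityA
      (pushforwardActivity (cellSupp Bond.verts) W (connectedCellSets Bond.verts (hubbardBonds G))) a δ := by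
  obtain ⟨h1, h2⟩ := Set.mem_prod.mp hζ
  have hz := ne_zero_of_mem_annulus h1
  have hw := ne_zero_of_mem_annulus h2
  have hz2 := zTwo_ne_zero hζ hβU
  have hs1 : s ≤ 1 := by
    have h65 : (1 : ℝ) ≤ ((8 * Δ : ℕ) + 1 : ℝ) ^ 2 := by
      have h0 : (0 : ℝ) ≤ ((8 * Δ : ℕ) : ℝ) := Nat.cast_nonneg _
      nlinarith
    have he : (1 : ℝ) ≤ Real.exp 6 * 1000 ^ 2 := by
      have := Real.add_one_le_exp (6 : ℝ)
      nlinarith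
    have h3 : s ≤ Real.exp 6 * 1000 ^ 2 * s := le_mul_of_one_le_left hs0 he
    have h4 : Real.exp 6 * 1000 ^ 2 * s ≤ ((8 * Δ : ℕ) + 1 : ℝ) ^ 2 * (Real.exp 6 * 1000 ^ 2 * s) :=
      le_mul_of_one_le_left (by positivity) h65
    linarith
  exact isSmallActivityA_pushforward_of_weight_bound hΔ W hs0 (by positivity) (twoFugacity_siteRatio_le hζ hβU)
    (by norm_num) (fun X _ => norm_twoFugacityWeight_le hz hw hz2 T hT W hW hs0 hs1 hc X) hsmall ha hδ had hsa

/-- Scaling a small activity by `|u| ≤ 1` keeps it small (used along the Kotecký–Preiss ray). -/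
theorem isSmallActivityA_mul_of_norm_le_one {α : Type*} [DecidableEq α] {ρ : Finset α → ℂ} {a δ : ℝ}
    (h : IsSmallActivityA ρ a δ) {u : ℂ} (hu : ‖u‖ ≤ 1) : IsSmallActivityA (fun γ => u * ρ γ) a δ where
  rho_empty := by rw [h.rho_empty, mul_zero]
  a_pos := h.a_pos
  delta_pos := h.delta_pos
  sum_le x 𝒜 h𝒜 := by
    refine le_trans (Finset.sum_le_sum fun A _ => ?_) (h.sum_le x 𝒜 h𝒜)
    rw [norm_mul]
    exact mul_le_mul_of_nonneg_right (mul_le_of_le_one_left (norm_nonneg _) hu) (Real.exp_nonneg _)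

/-- The sum of a nonnegative set function vanishing at `∅` over all subsets is at most the sum over sites of its
one-site sums (copy of the tree's `sum_powerset_le_sum_sum_filter_mem`, not importable here without a heavy module). -/
theorem sum_powerset_le_sum_sum_filter_mem' {α : Type*} [Fintype α] [DecidableEq α] {g : Finset α → ℝ}
    (hg : ∀ A, 0 ≤ g A) (h0 : g ∅ = 0) :
    ∑ A ∈ (Finset.univ : Finset α).powerset, g A ≤
      ∑ x : α, ∑ A ∈ (Finset.univ : Finset α).powerset.filter (fun A => x ∈ A), g A := by
  have h1 : ∀ A ∈ (Finset.univ : Finset α).powerset, g A ≤ ∑ x : α, if x ∈ A then g A else 0 := by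
    intro A _
    rw [← Finset.sum_filter, Finset.filter_mem_eq_inter, Finset.univ_inter, Finset.sum_const,
      nsmul_eq_mul]
    rcases A.eq_empty_or_nonempty with rfl | hA
    · simp [h0]
    · have : (1 : ℝ) ≤ A.card := by exact_mod_cast Finset.card_pos.2 hA
      nlinarith [hg A]
  refine (Finset.sum_le_sum h1).trans ?_
  rw [Finset.sum_comm]
  refine Finset.sum_le_sum fun x _ => ?_
  rw [Finset.sum_filter]

/-- **The free-energy bound** `‖log Ξ(ρ)‖ ≤ a · #sites` for a small activity of weight `a` (Lipschitz bound of the Kotecký–Preiss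
logarithm against the zero activity, then the anchored one-site sums; abstract form of the tree's `norm_polymerLogZ_ttActivityMu_le`). -/
theorem norm_polymerLogZ_le_of_isSmallActivityA {α : Type*} [Fintype α] [DecidableEq α] {ρ : Finset α → ℂ} {a δ : ℝ}
    (hS : IsSmallActivityA ρ a δ) :
    ‖polymerLogZ polyInc ρ (Finset.univ : Finset α).powerset‖ ≤ a * Fintype.card α := by
  have hA := hS.isKPVolume (Finset.univ : Finset α).powerset
  have hB : IsKPVolume polyInc (0 : Finset α → ℂ) (fun A : Finset α => a * (A.card : ℝ))
      (Finset.univ : Finset α).powerset := by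
    intro γ _
    rw [Finset.sum_eq_zero fun γ' _ => by simp [kpTerm]]
    exact mul_nonneg hS.a_pos.le (Nat.cast_nonneg _)
  have h := norm_polymerLogZ_sub_polymerLogZ_le hA hB
  rw [ContourModel.polymerLogZ_zero, sub_zero] at h
  refine h.trans ?_
  simp only [Pi.zero_apply, sub_zero]
  have hg0 : ∀ A : Finset α, 0 ≤ ‖ρ A‖ * Real.exp (a * (A.card : ℝ)) := fun A => by positivity
  have hge : ‖ρ ∅‖ * Real.exp (a * ((∅ : Finset α).card : ℝ)) = 0 := by
    rw [hS.rho_empty, norm_zero, zero_mul]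
  refine (sum_powerset_le_sum_sum_filter_mem' hg0 hge).trans ?_
  calc ∑ x : α, ∑ A ∈ (Finset.univ : Finset α).powerset.filter (fun A => x ∈ A), ‖ρ A‖ * Real.exp (a * (A.card : ℝ))
      ≤ ∑ _x : α, a := by
        refine Finset.sum_le_sum fun x _ => ?_
        refine le_trans (Finset.sum_le_sum fun A _ => ?_) (hS.sum_le x _ fun A hA => (Finset.mem_filter.1 hA).2)
        refine mul_le_mul_of_nonneg_left (Real.exp_le_exp.2 ?_) (norm_nonneg _)
        exact mul_le_mul_of_nonneg_right (le_add_of_nonneg_right hS.delta_pos.le) (Nat.cast_nonneg _)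
    _ = a * Fintype.card α := by
        rw [Finset.sum_const, Finset.card_univ, nsmul_eq_mul, mul_comm]

omit [LinearOrder Λ] [Fintype Λ] in
/-- The annulus pair is open. -/
theorem isOpen_annulus_prod :
    IsOpen ({ζ : ℂ | 2 / 3 < ‖ζ‖ ∧ ‖ζ‖ < 8 / 9} ×ˢ {ζ : ℂ | 2 / 3 < ‖ζ‖ ∧ ‖ζ‖ < 8 / 9}) := by
  have h : IsOpen {ζ : ℂ | 2 / 3 < ‖ζ‖ ∧ ‖ζ‖ < 8 / 9} := by
    have : {ζ : ℂ | 2 / 3 < ‖ζ‖ ∧ ‖ζ‖ < 8 / 9} = (fun ζ : ℂ => ‖ζ‖) ⁻¹' Set.Ioo (2 / 3) (8 / 9) := rfl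
    rw [this]
    exact isOpen_Ioo.preimage continuous_norm
  exact h.prod h

/-- **Holomorphy of the local Gibbs ratios in the fugacities.** For couplings on bonds inside `A` and `‖βU‖ ≤ 1/256`,
`(ζ↑, ζ↓) ↦ Zc₂(c)/Zc₂(0)` is complex-differentiable on the annulus pair: by parts 6 and 8 it is the entire unfused local trace
`tr( diag(∏_{x∈A} ζ↑^{[x↑∈s]} ζ↓^{[x↓∈s]}) e^{−βV_A + Σ c_b T_b} )` divided by `z₂^{|A|} 4^{|Λ|−|A|} ≠ 0`. -/
theorem differentiableOn_twoFugacity_ratio {β U : ℂ} (hβU : ‖β * U‖ ≤ 1 / 256) {A : Finset Λ} {c : Bond Λ → ℂ}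
    (hc : ∀ b, c b ≠ 0 → b.1 ∈ A ∧ b.2.1 ∈ A) :
    DifferentiableOn ℂ (fun ζ : ℂ × ℂ =>
      (NormedSpace.exp (-(β • onSiteSum U 0 (univ : Finset Λ)) +
          (∑ x ∈ (univ : Finset Λ), (Complex.log ζ.1 • numberOp x 0 + Complex.log ζ.2 • numberOp x 1)) +
            hopSum c)).trace /
        (NormedSpace.exp (-(β • onSiteSum U 0 (univ : Finset Λ)) +
          (∑ x ∈ (univ : Finset Λ), (Complex.log ζ.1 • numberOp x 0 + Complex.log ζ.2 • numberOp x 1)) +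
            hopSum 0)).trace)
      ({ζ : ℂ | 2 / 3 < ‖ζ‖ ∧ ‖ζ‖ < 8 / 9} ×ˢ {ζ : ℂ | 2 / 3 < ‖ζ‖ ∧ ‖ζ‖ < 8 / 9}) := by
  classical
  have hnum : DifferentiableOn ℂ (fun ζ : ℂ × ℂ =>
      (diagonal (fun s : Finset (Orb Λ) =>
          ∏ x, if x ∈ A then (if x ∈ upPart s then ζ.1 else 1) * (if x ∈ downPart s then ζ.2 else 1) else 1) *
        NormedSpace.exp (-(β • onSiteSum U 0 A) + hopSum c)).trace)
      ({ζ : ℂ | 2 / 3 < ‖ζ‖ ∧ ‖ζ‖ < 8 / 9} ×ˢ {ζ : ℂ | 2 / 3 < ‖ζ‖ ∧ ‖ζ‖ < 8 / 9}) :=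
    (analyticOnNhd_localFugacityTrace A _).differentiableOn.mono (Set.subset_univ _)
  have hden : DifferentiableOn ℂ (fun ζ : ℂ × ℂ =>
      (1 + ζ.1 + ζ.2 + ζ.1 * ζ.2 * cexp (-(β * U))) ^ A.card * (4 : ℂ) ^ (Fintype.card Λ - A.card))
      ({ζ : ℂ | 2 / 3 < ‖ζ‖ ∧ ‖ζ‖ < 8 / 9} ×ˢ {ζ : ℂ | 2 / 3 < ‖ζ‖ ∧ ‖ζ‖ < 8 / 9}) := by
    fun_prop
  have hne : ∀ ζ ∈ ({ζ : ℂ | 2 / 3 < ‖ζ‖ ∧ ‖ζ‖ < 8 / 9} ×ˢ {ζ : ℂ | 2 / 3 < ‖ζ‖ ∧ ‖ζ‖ < 8 / 9}),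
      (1 + ζ.1 + ζ.2 + ζ.1 * ζ.2 * cexp (-(β * U))) ^ A.card * (4 : ℂ) ^ (Fintype.card Λ - A.card) ≠ 0 :=
    fun ζ hζ => mul_ne_zero (pow_ne_zero _ (zTwo_ne_zero hζ hβU)) (pow_ne_zero _ (by norm_num))
  have hg : DifferentiableOn ℂ (fun ζ : ℂ × ℂ =>
      (diagonal (fun s : Finset (Orb Λ) =>
          ∏ x, if x ∈ A then (if x ∈ upPart s then ζ.1 else 1) * (if x ∈ downPart s then ζ.2 else 1) else 1) *
        NormedSpace.exp (-(β • onSiteSum U 0 A) + hopSum c)).trace *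
        ((1 + ζ.1 + ζ.2 + ζ.1 * ζ.2 * cexp (-(β * U))) ^ A.card * (4 : ℂ) ^ (Fintype.card Λ - A.card))⁻¹)
      ({ζ : ℂ | 2 / 3 < ‖ζ‖ ∧ ‖ζ‖ < 8 / 9} ×ˢ {ζ : ℂ | 2 / 3 < ‖ζ‖ ∧ ‖ζ‖ < 8 / 9}) :=
    hnum.mul (hden.inv hne)
  refine hg.congr fun ζ hζ => ?_
  · obtain ⟨h1, h2⟩ := Set.mem_prod.mp hζ
    have hz := ne_zero_of_mem_annulus h1
    have hw := ne_zero_of_mem_annulus h2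
    have hz2 := zTwo_ne_zero hζ hβU
    have h := twoFugacity_ratio_eq_div hz hw hz2
      (fun c' => (NormedSpace.exp (-(β • onSiteSum U 0 (univ : Finset Λ)) +
          (∑ x ∈ (univ : Finset Λ), (Complex.log ζ.1 • numberOp x 0 + Complex.log ζ.2 • numberOp x 1)) +
            hopSum c')).trace) (fun _ => rfl) hc
    beta_reduce at h
    rw [h, trace_exp_twoFugacityLocal_hopSum_eq β U hz hw hc, trace_exp_twoFugacityLocal β U hz hw A, div_eq_mul_inv]

/-- **Holomorphy of the site activities in the fugacities**: each pushforward activity of the inclusion–exclusion weights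
`W(K) = Σ_{K'⊆K} (−1)^{|K∖K'|} Zc₂(c|_{K'})/Zc₂(0)` is complex-differentiable on the annulus pair. -/
theorem differentiableOn_twoFugacity_pushforward {β U : ℂ} (hβU : ‖β * U‖ ≤ 1 / 256) (c : Bond Λ → ℂ)
    (P : Finset (Bond Λ)) (γ : Finset Λ) :
    DifferentiableOn ℂ (fun ζ : ℂ × ℂ =>
      pushforwardActivity (cellSupp Bond.verts)
        (fun K => ∑ K' ∈ K.powerset, (-1) ^ (K \ K').card *
          ((NormedSpace.exp (-(β • onSiteSum U 0 (univ : Finset Λ)) +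
              (∑ x ∈ (univ : Finset Λ), (Complex.log ζ.1 • numberOp x 0 + Complex.log ζ.2 • numberOp x 1)) +
                hopSum (restrictCoupling c K'))).trace /
            (NormedSpace.exp (-(β • onSiteSum U 0 (univ : Finset Λ)) +
              (∑ x ∈ (univ : Finset Λ), (Complex.log ζ.1 • numberOp x 0 + Complex.log ζ.2 • numberOp x 1)) +
                hopSum 0)).trace))
        (connectedCellSets Bond.verts P) γ)
      ({ζ : ℂ | 2 / 3 < ‖ζ‖ ∧ ‖ζ‖ < 8 / 9} ×ˢ {ζ : ℂ | 2 / 3 < ‖ζ‖ ∧ ‖ζ‖ < 8 / 9}) := by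
  simp_rw [pushforwardActivity_apply]
  refine DifferentiableOn.fun_sum fun X _ => DifferentiableOn.fun_sum fun K' _ => ?_
  exact (differentiableOn_const _).mul
    (differentiableOn_twoFugacity_ratio hβU (A := cellSupp Bond.verts K') fun b hb =>
      endpoints_mem_cellSupp (mem_of_restrictCoupling_ne_zero hb))

/-- **Instance irrelevance of the two-fugacity trace.** The generalised Gibbs factor does not depend on the `DecidableEq`
instance on configurations through which the matrix ring structure is found (used to pass between the instance synthesized on
the concrete torus and the one carried by the generic lemmas). -/
theorem twoFugacity_trace_instIrrel (β U z w : ℂ) (c : Bond Λ → ℂ) (d₁ d₂ : DecidableEq (Finset (Orb Λ))) :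
    (haveI := d₁; (NormedSpace.exp (-(β • onSiteSum U 0 (univ : Finset Λ)) +
      (∑ x ∈ (univ : Finset Λ), (Complex.log z • numberOp x 0 + Complex.log w • numberOp x 1)) + hopSum c)).trace) =
    (haveI := d₂; (NormedSpace.exp (-(β • onSiteSum U 0 (univ : Finset Λ)) +
      (∑ x ∈ (univ : Finset Λ), (Complex.log z • numberOp x 0 + Complex.log w • numberOp x 1)) + hopSum c)).trace) := by
  obtain rfl : d₁ = d₂ := Subsingleton.elim _ _
  rfl

/-- **The two-fugacity cluster representation on a graph of maximal degree `Δ`** (parts 1–9 assembled; Ueltschi's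
Theorem 2.1 / Proposition 2.2 for the two-complex-fugacity coupling polymer gas). For `‖βU‖ ≤ 1/256`, couplings `c` on the bonds
of `G` with `|c_b| ≤ s`, `(8Δ+1)² e⁶10⁶ s ≤ 1/2` and `8Δ e⁶10⁶ s ≤ a ≤ 1`, there is `P` (the logarithm of the cluster partition
function, `P = log Ξ(ρ)`), complex-differentiable on the annulus pair with `‖P‖ ≤ a |Λ|`, such that
`tr e^{−βV + F(ζ) + Σ c_b T_b} = z₂(ζ)^{|Λ|} e^{P(ζ)}` on the annulus pair. -/
theorem twoFugacity_cluster {G : SimpleGraph Λ} [DecidableRel G.Adj] {Δ : ℕ}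
    (hΔ : ∀ v : Λ, (Finset.univ.filter (G.Adj v)).card ≤ Δ) {β U : ℂ} (hβU : ‖β * U‖ ≤ 1 / 256)
    {c : Bond Λ → ℂ} (hPc : ∀ b, c b ≠ 0 → b ∈ hubbardBonds G)
    {s : ℝ} (hs0 : 0 ≤ s) (hc : ∀ b, ‖c b‖ ≤ s)
    (hsmall : ((8 * Δ : ℕ) + 1 : ℝ) ^ 2 * (Real.exp 6 * 1000 ^ 2 * s) ≤ 1 / 2)
    {a : ℝ} (ha : 0 < a) (ha1 : a ≤ 1) (hsa : 8 * Δ * (Real.exp 6 * 1000 ^ 2 * s) ≤ a) :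
    ∃ P : ℂ × ℂ → ℂ,
      DifferentiableOn ℂ P ({ζ : ℂ | 2 / 3 < ‖ζ‖ ∧ ‖ζ‖ < 8 / 9} ×ˢ {ζ : ℂ | 2 / 3 < ‖ζ‖ ∧ ‖ζ‖ < 8 / 9}) ∧
      (∀ ζ ∈ ({ζ : ℂ | 2 / 3 < ‖ζ‖ ∧ ‖ζ‖ < 8 / 9} ×ˢ {ζ : ℂ | 2 / 3 < ‖ζ‖ ∧ ‖ζ‖ < 8 / 9}),
        ‖P ζ‖ ≤ a * Fintype.card Λ) ∧
      ∀ ζ ∈ ({ζ : ℂ | 2 / 3 < ‖ζ‖ ∧ ‖ζ‖ < 8 / 9} ×ˢ {ζ : ℂ | 2 / 3 < ‖ζ‖ ∧ ‖ζ‖ < 8 / 9}),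
        (NormedSpace.exp (-(β • onSiteSum U 0 (univ : Finset Λ)) +
          (∑ x ∈ (univ : Finset Λ), (Complex.log ζ.1 • numberOp x 0 + Complex.log ζ.2 • numberOp x 1)) +
            hopSum c)).trace =
          (1 + ζ.1 + ζ.2 + ζ.1 * ζ.2 * cexp (-(β * U))) ^ Fintype.card Λ * cexp (P ζ) := by
  -- the objects, generalised: the Gibbs factor `T`, the bond weights `W`, the site activity `ρ`
  obtain ⟨T, hT⟩ : ∃ T : ℂ × ℂ → (Bond Λ → ℂ) → ℂ, ∀ ζ c', T ζ c' =
      (NormedSpace.exp (-(β • onSiteSum U 0 (univ : Finset Λ)) +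
        (∑ x ∈ (univ : Finset Λ), (Complex.log ζ.1 • numberOp x 0 + Complex.log ζ.2 • numberOp x 1)) +
          hopSum c')).trace :=
    ⟨_, fun _ _ => rfl⟩
  obtain ⟨W, hW⟩ : ∃ W : ℂ × ℂ → Finset (Bond Λ) → ℂ, ∀ ζ K, W ζ K =
      ∑ K' ∈ K.powerset, (-1) ^ (K \ K').card * (T ζ (restrictCoupling c K') / T ζ 0) :=
    ⟨_, fun _ _ => rfl⟩
  obtain ⟨ρ, hρ⟩ : ∃ ρ : ℂ × ℂ → Finset Λ → ℂ, ∀ ζ, ρ ζ =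
      pushforwardActivity (cellSupp Bond.verts) (W ζ) (connectedCellSets Bond.verts (hubbardBonds G)) :=
    ⟨_, fun _ => rfl⟩
  -- Kotecký–Preiss smallness at every point of the annulus pair (weight `a`, decay `1`)
  have hS : ∀ ζ ∈ ({ζ : ℂ | 2 / 3 < ‖ζ‖ ∧ ‖ζ‖ < 8 / 9} ×ˢ {ζ : ℂ | 2 / 3 < ‖ζ‖ ∧ ‖ζ‖ < 8 / 9}),
      IsSmallActivityA (ρ ζ) a 1 := fun ζ hζ => by
    rw [hρ]
    exact isSmallActivityA_twoFugacity hΔ hζ hβU (T ζ) (hT ζ) (W ζ) (hW ζ) hs0 hc hsmall ha one_pos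
      (by linarith) hsa
  have hU := isOpen_annulus_prod
  refine ⟨fun ζ => polymerLogZ polyInc (ρ ζ) (Finset.univ : Finset Λ).powerset, ?_, ?_, ?_⟩
  · -- holomorphy: the activities are holomorphic (part 8 through the ratios), `Ξ ≠ 0` along the ray, part 9bis
    have hρd : ∀ γ : Finset Λ, DifferentiableOn ℂ (fun ζ : ℂ × ℂ => ρ ζ γ)
        ({ζ : ℂ | 2 / 3 < ‖ζ‖ ∧ ‖ζ‖ < 8 / 9} ×ˢ {ζ : ℂ | 2 / 3 < ‖ζ‖ ∧ ‖ζ‖ < 8 / 9}) := fun γ => by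
      have e : (fun ζ : ℂ × ℂ => ρ ζ γ) = fun ζ : ℂ × ℂ =>
          pushforwardActivity (cellSupp Bond.verts)
            (fun K => ∑ K' ∈ K.powerset, (-1) ^ (K \ K').card *
              ((NormedSpace.exp (-(β • onSiteSum U 0 (univ : Finset Λ)) +
                  (∑ x ∈ (univ : Finset Λ), (Complex.log ζ.1 • numberOp x 0 + Complex.log ζ.2 • numberOp x 1)) +
                    hopSum (restrictCoupling c K'))).trace /
                (NormedSpace.exp (-(β • onSiteSum U 0 (univ : Finset Λ)) +
                  (∑ x ∈ (univ : Finset Λ), (Complex.log ζ.1 • numberOp x 0 + Complex.log ζ.2 • numberOp x 1)) +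
                    hopSum 0)).trace))
            (connectedCellSets Bond.verts (hubbardBonds G)) γ := by
        funext ζ
        rw [hρ ζ]
        congr 1
        funext K
        rw [hW ζ K]
        simp only [hT]
      rw [e]
      exact differentiableOn_twoFugacity_pushforward hβU _ _ γ
    refine differentiableOn_polymerLogZ_param (inc := polyInc) _ hU (fun γ _ => hρd γ) (fun ζ hζ u hu => ?_)
    have hu1 : ‖(u : ℂ)‖ ≤ 1 := by
      rw [Complex.norm_real, Real.norm_eq_abs, abs_of_nonneg hu.1]; exact hu.2
    exact (isSmallActivityA_mul_of_norm_le_one (hS ζ hζ) hu1).polymerPartitionFunction_ne_zero _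
  · -- the bound `‖log Ξ‖ ≤ a |Λ|`
    intro ζ hζ
    exact norm_polymerLogZ_le_of_isSmallActivityA (hS ζ hζ)
  · -- the representation: factorisation property, polymer representation, exponential formula
    intro ζ hζ
    obtain ⟨hζ1, hζ2⟩ := Set.mem_prod.mp hζ
    have hz := ne_zero_of_mem_annulus hζ1
    have hw := ne_zero_of_mem_annulus hζ2
    have hz2 := zTwo_ne_zero hζ hβU
    have hT0 : T ζ 0 = (1 + ζ.1 + ζ.2 + ζ.1 * ζ.2 * cexp (-(β * U))) ^ Fintype.card Λ := by
      rw [hT]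
      exact trace_exp_twoFugacity_zero β U hz hw
    have h0 : T ζ 0 ≠ 0 := by rw [hT0]; exact pow_ne_zero _ hz2
    have hfac : ∀ ⦃A₁ A₂ : Finset Λ⦄, Disjoint A₁ A₂ → ∀ ⦃c₁ c₂ : Bond Λ → ℂ⦄,
        (∀ b, c₁ b ≠ 0 → b.1 ∈ A₁ ∧ b.2.1 ∈ A₁) → (∀ b, c₂ b ≠ 0 → b.1 ∈ A₂ ∧ b.2.1 ∈ A₂) →
        T ζ (c₁ + c₂) * T ζ 0 = T ζ c₁ * T ζ c₂ :=
      fun A₁ A₂ hA c₁ c₂ hc₁ hc₂ => trace_exp_twoFugacity_add_mul β U ζ.1 ζ.2 hA hc₁ hc₂ (T ζ) (hT ζ)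
    have hrep := eq_mul_polymerPartitionFunction_of_factorising (T ζ) h0 hfac _ (W ζ) (hW ζ) _ hPc
    have hΞ := (hS ζ hζ).exp_polymerLogZ (Finset.univ : Finset Λ).powerset
    rw [← hT ζ c, hrep, hT0, ← hρ ζ, ← hΞ]

end General

end Summit.Ventures.CertifiedManyBodySolver.Theorems.TcThermcert1.ZeroFreeCorridor
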